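import Summits.QuantumFields.YangMills.Theorems.BalabanUVNodesN07TildeTowerLettersFromFine
import Literature.MathematicalPhysics.QuantumFieldTheory.Balaban1983to89.Node00.TorusCoverCollarOfMeetsPrint
import Literature.MathematicalPhysics.QuantumFieldTheory.Balaban1983to89.Node00.Record12BgRowTopDomain
import HarnessLib

/-!
# DAG node N07 [B11] — (144)∕p. 300 «`□̃ ⊂ 𝔅_{j−1}`» AS PRINTED: THE PLACEMENT OF THE WIDENED □̃ AT A TOKEN DATUM, so that FILE-2(g2)'s fine-regularity input IS the token's (17)
# clause ONE LEVEL DOWN (`α₀ := L²·ε_{n−1}`) — the S6 head's canonical-box `v`-clause at a datum with ONLY the radial tower, print's separation, the datum's meet, one floor,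
# the level-`(n−1)` (17) clause, the `ε` range and non-wrapping displayed

Cell `pub-ymgap` (HUMAN RULINGS D-0062 ∕ D-0088 ∕ D-0149), width seat `pub-ymgap-dag-n07-w6` (second wave), harness re-seat g2, 2026-08-28; CLAIM-3 ∕ INTENT-3 (cell bus).
`--kind proof --supports stmt-QuantumFields-27364 --as helper` (K1⁹ per dag-lead KEY MAP v2; count-neutral).  THEOREMS ONLY.

THE PRINT.  [B11] = [Balaban1985Variational] p. 300: «Let us take a cube `□` … intersecting `Ω_j` … the cube `□̃` … `□̃ ⊂ B^{j−1}(Λ_{j−1}) ∪ B^j(Λ_j)` … the configuration `U′` is regular on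
`□̃`» — i.e. (144): the enlarged cube sits inside `𝔅_{j−1}`, where (17)∕(7) at level `j − 1` control the fine plaquettes; [6] = [Balaban1985RegularSpaces] (1.3)–(1.6) p. 77 (separated
admissible sequences: one layer of `LⁿM₁`-cubes), p. 98 (`□̃`); [III] = [Balaban1988Convergent] p. 255 (the support `Ω₁ +` one layer of `M₁`-cubes), (2.13) p. 256.

WHAT THIS FILE DOES (integer bookkeeping on box coordinates + print's separation BY NAME; NOTHING of [B11]∕[6]∕[III] analysis asserted).
* §1 ★ `within_of_mem_tildeTowerWide_zero`: every label of FILE-2's WIDENED fine □̃ of the datum `(cornerP Mc ρ idx, sideP Mc ρ, ρ, n)` is within `Lⁿ·E₁` of every point of the grid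
  cube `cubeExt (LⁿMc) idx`, `E₁ := Mc + 11d + 4ρ + 2(L + R)`, `R := (d+4)L + 2` (36a `gridFloor_le`∕`lt_gridFloor_add`∕`sideP_le` + `B8Eq131Cubes.margin_own`).
* §2 ★★ `cover_mem_Ω_pred_of_mem_tildeTowerWide_zero` (`2 ≤ n ≤ k`: the widened fine □̃ projects into `Ω_{n−1}` — node00's `cover_mem_of_within_of_seqSeparated`, floor `E₁ + Dw ≤ M₁`),
  ★ `cover_mem_hullD_of_mem_tildeTowerWide_zero` (`n = 1`: into the support `hullD P M₁ 1 (Ω 1)` — `cover_mem_hullD_one_of_within`, floor `L·E₁ + Dw ≤ M₁`),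
  ★★ `mem_omegaPlaqsTop_pred_of_mem_tildeTowerWide_zero` (both cases: FILE-2's level-0 family ⊆ `Sect2.omegaPlaqsTop s.Ω (hullD P M₁ 1 (s.Ω 1)) (n − 1)`, single floor `L·E₁ + Dw ≤ M₁`).
* §3 `mul_eta_pred_sq` (`ε·η_{n−1}² = (L²ε)·η_n²`), `plaqSmallOn_gaugeAct_iff` (fine plaquette smallness is gauge-invariant: FILE 4's WLOG representative inherits (17)),
  ★★★ `dist1_iter_le_down_the_radialRep_levelBoxes_at_datum` = FILE-2's ★★★ `…_levelBoxes_of_fine` with `h52` DISCHARGED from the (17) clause at level `n − 1` (`α₀ := L²ε`): the canonical-box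
  `v`-clause of the S6 head AT A TOKEN DATUM with the explicit ladder AFFINE in `ε` (= `ε_{n−1} ≤ 2ε_n` by the token's comparability).

HONEST FRAMING (binding).  Count-neutral helper; by-name composition of LANDED theorems (FILE-2(g2), node00 `TorusCoverCubeMember`∕`TorusCoverGaugeTokensR`∕`TorusCoverCubeMemberPrint`,
`Record12BgRowTopDomain`) + label arithmetic; the radial tower of the representative, `Sect2.SeqSeparated`, the datum's meet witness, the floor, the level-`(n−1)` (17) clause, the `ε`
range and non-wrapping are HYPOTHESES ∕ the consumer's (the S6 head's `HCHART` needs the meet antecedent to read them — LOCATED-HCHART-NO-MEET on the cell bus); nothing of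
[B11]∕[6]∕[III] analysis asserted; `HCHART` NOT discharged; `stub_prop8StepCoP13` ∕ K0⁷ ∕ K1⁹ NOT closed; N07 NOT discharged; the chair's tally of record is the only count; **no
summit statement is proved by this seat** — one finite `T⁴` programme at fixed `ε`, Bałaban AS PRINTED; the route closes the conditional finite-𝕋⁴ rung `BalabanLadder.UV` only; NOT
continuum ∕ ℝ⁴ ∕ OS ∕ mass gap ∕ Clay.  No `sorry`, no `def`, no `instance`, no `notation`.

RELATED IN THE TREE, NOT DUPLICATED: node00 `TorusCoverCollarOfMeetsPrint` (`Sect2.cover_mem_Ω_pred_of_near_box_propCubeP` — the `n ≥ 2` margin lemma for points NEAR THE PRINT BOX;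
here the widened □̃ is placed directly from the grid cube, both `n ≥ 2` and `n = 1`), FILE-2(g2) (CONSUMED).
-/

noncomputable section

namespace Summit.QuantumFields.YangMills.BalabanUVNodes.N07TildeTowerLettersAtDatum

open scoped Matrix.Norms.L2Operator BigOperators
open Literature.MathematicalPhysics.QuantumFieldTheory.Balaban1983to89
open Literature.MathematicalPhysics.QuantumFieldTheory.Balaban1983to89.Node00
open T4Continuum
open T4AxialGaugeSmallField (castSite castSite_apply axialGauge boxPlaqs)
open B15Eq177GaugeInvariance (blockLift)
open B15Eq112TorusCover (cover)
open B14DomainGeom (Pt Within)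
open B14.Eq213MaximalDomains (side cubeExt)
open GaugeField (gaugeAct)
open ExpMeanLog (deltaSU)
open B8Eq131Cubes (gs sqLo sqHi tLo tHi margin_own)
open B8Ineq130 (tlo thi tlo_apply thi_apply)
open Summit.QuantumFields.Balaban3D.Carriers (radialContourData)
open Summit.QuantumFields.YangMills.BalabanUVNodes.N07TildeTowerLettersFromFine (dist1_iter_le_down_the_radialRep_levelBoxes_of_fine)

/-! ## §1  The widened fine □̃ of a datum is within `Lⁿ·E₁` of its grid cube -/

section Geometry

variable {P : Params}

/-- ★ **THE WIDENED FINE □̃ IS WITHIN `Lⁿ·E₁` OF THE GRID CUBE**, `E₁ := Mc + 11d + 4ρ + 2(L + R)`: the print corner `cornerP Mc ρ idx` is less than `ρ` below `Mc·idx` (36a), the print side is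
`≤ Mc + 11d + 2ρ`, the □̃ collar is `2ρ`, and FILE-2's widening `(L+R)·gs L n ≤ 2(L+R)Lⁿ`. [cite: Balaban1985Variational, (144) p.300; Balaban1985RegularSpaces, p.98] -/
theorem within_of_mem_tildeTowerWide_zero {Mc ρ R n : ℕ} (hρ : 0 < ρ) {idx x z : Pt P.d} (hx : x ∈ cubeExt (side P.L Mc n) idx 0)
    (hz : ∀ κ, tlo P.L (tLo (cornerP P Mc ρ idx) ρ) n κ - (((P.L + R) * gs P.L n : ℕ) : ℤ) ≤ z κ ∧
      z κ ≤ thi P.L (tHi (cornerP P Mc ρ idx) (sideP P Mc ρ) ρ) n κ + (((P.L + R) * gs P.L n : ℕ) : ℤ)) :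
    Within (((P.L ^ n * (Mc + 11 * P.d + 4 * ρ + 2 * (P.L + R)) : ℕ) : ℤ)) z x := by
  have hL2 : 2 ≤ P.L := by have := P.hL.2; omega
  have hL0 : (0 : ℤ) ≤ (P.L : ℤ) ^ n := by positivity
  intro i
  obtain ⟨hx1, hx2⟩ := hx i
  obtain ⟨hz1, hz2⟩ := hz i
  simp only [sub_zero, add_zero] at hx1 hx2
  rw [tlo_apply] at hz1
  rw [thi_apply] at hz2
  simp only [tLo, tHi] at hz1 hz2
  have hc1 : cornerP P Mc ρ idx i ≤ (Mc : ℤ) * idx i := gridFloor_le hρ _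
  have hc2 : (Mc : ℤ) * idx i < cornerP P Mc ρ idx i + ρ := lt_gridFloor_add hρ _
  have hS : ((sideP P Mc ρ : ℕ) : ℤ) ≤ ((Mc + 11 * P.d + 2 * ρ : ℕ) : ℤ) := by exact_mod_cast sideP_le (P := P) Mc ρ
  have hm : (((P.L + R) * gs P.L n : ℕ) : ℤ) ≤ ((P.L ^ n * (2 * (P.L + R)) : ℕ) : ℤ) := by exact_mod_cast margin_own hL2 n
  have hside : ((side P.L Mc n : ℕ) : ℤ) = (P.L : ℤ) ^ n * Mc := by rw [side]; push_cast; ring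
  rw [hside] at hx1 hx2
  push_cast at hS hm hz1 hz2 ⊢
  have p1 : (P.L : ℤ) ^ n * cornerP P Mc ρ idx i ≤ (P.L : ℤ) ^ n * ((Mc : ℤ) * idx i) := mul_le_mul_of_nonneg_left hc1 hL0
  have p2 : (P.L : ℤ) ^ n * ((Mc : ℤ) * idx i) ≤ (P.L : ℤ) ^ n * (cornerP P Mc ρ idx i + ρ) := mul_le_mul_of_nonneg_left hc2.le hL0
  have p3 : (P.L : ℤ) ^ n * ((sideP P Mc ρ : ℕ) : ℤ) ≤ (P.L : ℤ) ^ n * ((Mc : ℤ) + 11 * (P.d : ℤ) + 2 * (ρ : ℤ)) := mul_le_mul_of_nonneg_left hS hL0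
  rw [abs_le]
  constructor <;> nlinarith [p1, p2, p3, hL0, hm, hz1, hz2, hx1, hx2]

end Geometry

/-! ## §2  The placement: the widened fine □̃ projects into `Ω_{n−1}` (`n ≥ 2`) ∕ into the support (`n = 1`) -/

section Placement

variable {P : Params} {D : ℕ → Set (Set (Site P 0))} {k : ℕ}

/-- ★★ **[B11] p. 300 «`□̃ ⊂ 𝔅_{j−1}`», WIDENED, AT A DATUM OF LEVEL `2 ≤ n ≤ k`**: for a SEPARATED sequence (one layer of `LⁿM₁`-cubes of `Ω_{n−1}` around `Ω_n`), a grid cube with a point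
within `Dw` of a lift of a site of `Ω_n`, and the floor `E₁ + Dw ≤ M₁`, every label of the widened fine □̃ projects into `Ω_{n−1}`.
[cite: Balaban1985Variational, (144) p.300; Balaban1985RegularSpaces, (1.3)–(1.6) p.77, p.98; Balaban1988Convergent, (2.13) p.256] -/
theorem cover_mem_Ω_pred_of_mem_tildeTowerWide_zero {M₁ : ℕ} (hM₁ : 1 ≤ M₁) (s : B14.Eq218Concrete.Seq D k) (hsep : Sect2.SeqSeparated M₁ s)
    {Mc ρ R Dw : ℕ} (hρ : 0 < ρ) (hfloor : Mc + 11 * P.d + 4 * ρ + 2 * (P.L + R) + Dw ≤ M₁) {n : ℕ} (hn : 2 ≤ n) (hnk : n ≤ k)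
    {idx x y : Pt P.d} (hx : x ∈ cubeExt (side P.L Mc n) idx 0) (hy : cover P y ∈ s.Ω n) (hxy : Within (Dw : ℤ) x y) {z : Pt P.d}
    (hz : ∀ κ, tlo P.L (tLo (cornerP P Mc ρ idx) ρ) n κ - (((P.L + R) * gs P.L n : ℕ) : ℤ) ≤ z κ ∧
      z κ ≤ thi P.L (tHi (cornerP P Mc ρ idx) (sideP P Mc ρ) ρ) n κ + (((P.L + R) * gs P.L n : ℕ) : ℤ)) :
    cover P z ∈ s.Ω (n - 1) := by
  have hw := (within_of_mem_tildeTowerWide_zero hρ hx hz).triangle hxy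
  obtain ⟨m, rfl⟩ : ∃ m, n = m + 1 := ⟨n - 1, by omega⟩
  rw [Nat.add_sub_cancel]
  refine cover_mem_of_within_of_seqSeparated hM₁ s hsep (by omega) (by omega) hy (hw.mono ?_)
  rw [side]
  have hL : (1 : ℤ) ≤ (P.L : ℤ) ^ (m + 1) := by exact_mod_cast Nat.one_le_pow _ _ P.L_pos
  have hf : ((Mc + 11 * P.d + 4 * ρ + 2 * (P.L + R) + Dw : ℕ) : ℤ) ≤ M₁ := by exact_mod_cast hfloor
  push_cast at hf ⊢
  nlinarith

/-- ★ **AT LEVEL `n = 1` THE WIDENED FINE □̃ PROJECTS INTO THE SUPPORT** `hullD P M₁ 1 (Ω 1)` ([III] p. 255: `Ω₁ +` one layer of `M₁`-cubes), floor `L·E₁ + Dw ≤ M₁`.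
[cite: Balaban1988Convergent, p.255, (2.13) p.256; Balaban1985Variational, (144) p.300; Balaban1985RegularSpaces, p.98] -/
theorem cover_mem_hullD_of_mem_tildeTowerWide_zero {M₁ : ℕ} (hM₁ : 1 ≤ M₁) {Ω : ℕ → Set (Site P 0)}
    {Mc ρ R Dw : ℕ} (hρ : 0 < ρ) (hfloor : P.L * (Mc + 11 * P.d + 4 * ρ + 2 * (P.L + R)) + Dw ≤ M₁)
    {idx x y : Pt P.d} (hx : x ∈ cubeExt (side P.L Mc 1) idx 0) (hy : cover P y ∈ Ω 1) (hxy : Within (Dw : ℤ) x y) {z : Pt P.d}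
    (hz : ∀ κ, tlo P.L (tLo (cornerP P Mc ρ idx) ρ) 1 κ - (((P.L + R) * gs P.L 1 : ℕ) : ℤ) ≤ z κ ∧
      z κ ≤ thi P.L (tHi (cornerP P Mc ρ idx) (sideP P Mc ρ) ρ) 1 κ + (((P.L + R) * gs P.L 1 : ℕ) : ℤ)) :
    cover P z ∈ hullD P M₁ 1 (Ω 1) := by
  have hw := (within_of_mem_tildeTowerWide_zero hρ hx hz).triangle hxy
  refine cover_mem_hullD_one_of_within (by omega) hy (hw.mono ?_)
  have hf : ((P.L * (Mc + 11 * P.d + 4 * ρ + 2 * (P.L + R)) + Dw : ℕ) : ℤ) ≤ M₁ := by exact_mod_cast hfloor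
  push_cast at hf ⊢
  nlinarith

/-- ★★ **THE WIDENED FINE □̃ LIES IN THE (17)-REGION ONE LEVEL DOWN** — both cases at once, single floor `L·E₁ + Dw ≤ M₁`: every fine plaquette based at a label of FILE-2's widened fine □̃
of a datum of level `1 ≤ n ≤ k` belongs to `Sect2.omegaPlaqsTop s.Ω (hullD P M₁ 1 (s.Ω 1)) (n − 1)` (plaquettes meeting `Ω_{n−1}`, resp. the support at `n = 1`) — the set the token's (17)
clause `PlaqSmallOn (Sect2.omegaPlaqsTop s.Ω Sup (n−1)) (ε_{n−1}η_{n−1}²) U` reads (`Sup = suppDomOfRecord = hullD … ν.M₁ 1 (Ω 1)` by `suppDomOfRecord_eq`).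
[cite: Balaban1985Variational, (144) p.300, (17) p.279; Balaban1985RegularSpaces, (1.7) p.77, p.98; Balaban1988Convergent, p.255, (2.13) p.256] -/
theorem mem_omegaPlaqsTop_pred_of_mem_tildeTowerWide_zero {M₁ : ℕ} (hM₁ : 1 ≤ M₁) (s : B14.Eq218Concrete.Seq D k) (hsep : Sect2.SeqSeparated M₁ s)
    {Mc ρ R Dw : ℕ} (hρ : 0 < ρ) (hfloor : P.L * (Mc + 11 * P.d + 4 * ρ + 2 * (P.L + R)) + Dw ≤ M₁) {n : ℕ} (hn : 1 ≤ n) (hnk : n ≤ k)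
    {idx x y : Pt P.d} (hx : x ∈ cubeExt (side P.L Mc n) idx 0) (hy : cover P y ∈ s.Ω n) (hxy : Within (Dw : ℤ) x y)
    {q : Plaq P 0} {z : Pt P.d}
    (hz : ∀ κ, tlo P.L (tLo (cornerP P Mc ρ idx) ρ) n κ - (((P.L + R) * gs P.L n : ℕ) : ℤ) ≤ z κ ∧
      z κ ≤ thi P.L (tHi (cornerP P Mc ρ idx) (sideP P Mc ρ) ρ) n κ + (((P.L + R) * gs P.L n : ℕ) : ℤ))
    (hq : q.src = castSite z) :
    q ∈ Sect2.omegaPlaqsTop s.Ω (hullD P M₁ 1 (s.Ω 1)) (n - 1) := by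
  unfold Sect2.omegaPlaqsTop
  rw [B8Eq17ClassAkV1.mem_plaqsOf]
  refine Or.inl ?_
  rw [hq]
  rcases Nat.eq_or_lt_of_le hn with h1 | h1
  · subst h1
    rw [if_pos rfl]
    exact cover_mem_hullD_of_mem_tildeTowerWide_zero hM₁ hρ hfloor hx hy hxy hz
  · rw [if_neg (by omega)]
    refine cover_mem_Ω_pred_of_mem_tildeTowerWide_zero hM₁ s hsep hρ ?_ (by omega) hnk hx hy hxy hz
    have : Mc + 11 * P.d + 4 * ρ + 2 * (P.L + R) ≤ P.L * (Mc + 11 * P.d + 4 * ρ + 2 * (P.L + R)) := Nat.le_mul_of_pos_left _ P.L_pos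
    omega

end Placement

/-! ## §3  Thresholds one level down, gauge invariance, and the capstone at a datum -/

section Datum

variable {P : Params}

/-- **(17) ONE LEVEL DOWN IN LEVEL-`n` LETTERS**: `ε·η_{n−1}² = (L²·ε)·η_n²` (`1 ≤ n`; `η_m = L^{−m}`). [cite: Balaban1985Variational, (17) p.279; Balaban1988Convergent, (2.17) p.257] -/
theorem mul_eta_pred_sq (P : Params) (ε : ℝ) {n : ℕ} (hn : 1 ≤ n) : ε * P.eta (n - 1) ^ 2 = ((P.L : ℝ) ^ 2 * ε) * P.eta n ^ 2 := by
  obtain ⟨m, rfl⟩ : ∃ m, n = m + 1 := ⟨n - 1, by omega⟩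
  have hL : (P.L : ℝ) ≠ 0 := by have := P.L_pos; positivity
  have key : P.eta m = (P.L : ℝ) * P.eta (m + 1) := by
    rw [Params.eta, Params.eta, pow_succ, mul_comm (((P.L : ℝ)⁻¹) ^ m) _, ← mul_assoc, mul_inv_cancel₀ hL, one_mul]
  rw [Nat.add_sub_cancel, key]
  ring

variable {G : Type*} [GaugeGroup G]

/-- **FINE PLAQUETTE SMALLNESS IS GAUGE-INVARIANT** (`U ↦ U^w`): the radial-tower representative of FILE 4's WLOG inherits the token's (17) clause. [cite: Balaban1985Variational, (17) p.279 (gauge invariance of the class)] -/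
theorem plaqSmallOn_gaugeAct_iff {j : ℕ} (S : Set (Plaq P j)) (δ : ℝ) (w : GaugeTransf P j G) (U : GaugeField P j G) :
    PlaqSmallOn S δ (gaugeAct w U) ↔ PlaqSmallOn S δ U := by
  refine forall₂_congr fun p _ => ?_
  rw [T4ReTrLipUnitary.plaqHol_gaugeAct, GaugeGroup.dist1_conj]

variable {F : T4Continuum.T4Family} {N : ℕ} [NeZero N] {K : ℕ} {D : ℕ → Set (Set (Site (F.P K) 0))} {k : ℕ}

/-- ★★★ **THE S6 HEAD's CANONICAL-BOX `v`-CLAUSE AT A TOKEN DATUM, FROM THE (17) CLAUSE ONE LEVEL DOWN** ([B11] (144)–(147), (151) with (146) supplied by [B7] Prop. 2 local and the placement p. 300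
«`□̃ ⊂ 𝔅_{j−1}`»): datum of level `1 ≤ n ≤ k`, `n ≤ m + K`, grid index `idx` with a meet witness (`x ∈ cubeExt (LⁿMc) idx`, `π y ∈ Ω_n`, `Within Dw x y`), separated sequence, floor
`L·(Mc + 11d + 4ρ + 2(L + R)) + Dw ≤ M₁` (`R = (d+4)L + 2`), `L ≤ ρ`, non-wrapping `sideP Mc ρ + 4ρ < sitesPerDir n`; a representative `U′` whose averages carry the radial tower below `n` and
whose fine plaquettes satisfy the (17) clause at level `n − 1` on `Sect2.omegaPlaqsTop s.Ω (hullD P M₁ 1 (s.Ω 1)) (n − 1)` with letter `ε` in the range `143((d+4)²∕4)²·L²ε ≤ ⅓`,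
`2L²ε ≤ 2δ_N∕((d+4)L)²`.  Then at `U″ := U′^{h̄}`, `h := axialGauge (M^n U′) (tLo a ρ) (tHi a M′ ρ)` (`a := cornerP Mc ρ idx`, `M′ := sideP Mc ρ`), every level-`j` bond `c` of p627154's
canonical box (four equations) obeys `dist1 (M^j U″ c) ≤ (d−1)(M′+4ρ−1)·2L²ε + C′·Σ_{i∈[j,n)} 2L²ε(Lⁱη_n)²` — AFFINE in `ε`, uniform in the datum.
[cite: Balaban1985Variational, (17) p.279, (144) p.300, (145)–(147) p.301, (151) p.301; Balaban1985Averaging, Prop. 2 (52)–(53) p.26; Balaban1985RegularSpaces, (1.3)–(1.7) p.77, p.98, Lemma 1 (1.25) p.79] -/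
theorem dist1_iter_le_down_the_radialRep_levelBoxes_at_datum {M₁ : ℕ} (hM₁ : 1 ≤ M₁) (s : B14.Eq218Concrete.Seq D k) (hsep : Sect2.SeqSeparated M₁ s)
    {n : ℕ} (hn1 : 1 ≤ n) (hnk : n ≤ k) (hnK : n ≤ (F.P K).m + (F.P K).K)
    {Mc ρ Dw : ℕ} (hρ : (F.P K).L ≤ ρ) (hfloor : (F.P K).L * (Mc + 11 * (F.P K).d + 4 * ρ + 2 * ((F.P K).L + (((F.P K).d + 4) * (F.P K).L + 2))) + Dw ≤ M₁)
    {idx : Pt (F.P K).d} (hdat : ∃ x y : Pt (F.P K).d, x ∈ cubeExt (side (F.P K).L Mc n) idx 0 ∧ cover (F.P K) y ∈ s.Ω n ∧ Within (Dw : ℤ) x y)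
    (hwrap : sideP (F.P K) Mc ρ + 4 * ρ < (F.P K).sitesPerDir n)
    (U' : GaugeField (F.P K) 0 (SU N)) (hax : ∀ i < n, AxialGauge (radialContourData (F.P K) i (SU N)) (Averaging.iter (avOfRecord F N K) i U'))
    {ε : ℝ} (hε : 0 < ε) (hε3 : (143 * (((((F.P K).d + 4 : ℕ) : ℝ)) ^ 2 / 4) ^ 2) * (((F.P K).L : ℝ) ^ 2 * ε) ≤ 1 / 3)
    (hε2 : 2 * (((F.P K).L : ℝ) ^ 2 * ε) ≤ 2 * deltaSU (Fin N) / ((((F.P K).d + 4) * (F.P K).L : ℕ) : ℝ) ^ 2)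
    (h17 : PlaqSmallOn (Sect2.omegaPlaqsTop s.Ω (hullD (F.P K) M₁ 1 (s.Ω 1)) (n - 1)) (ε * (F.P K).eta (n - 1) ^ 2) U')
    {lo hi : ℕ → Fin (F.P K).d → ℤ}
    (hlo0 : lo 0 = fun i => ((F.P K).L : ℤ) * (sqLo (F.P K).L (cornerP (F.P K) Mc ρ idx) ρ n 1 i - 1))
    (hhi0 : hi 0 = fun i => ((F.P K).L : ℤ) * (sqHi (F.P K).L (cornerP (F.P K) Mc ρ idx) (sideP (F.P K) Mc ρ) ρ n 1 i + 1) + (((F.P K).L : ℤ) - 1))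
    (hloj : ∀ j, 1 ≤ j → lo j = sqLo (F.P K).L (cornerP (F.P K) Mc ρ idx) ρ n j - 1)
    (hhij : ∀ j, 1 ≤ j → hi j = sqHi (F.P K).L (cornerP (F.P K) Mc ρ idx) (sideP (F.P K) Mc ρ) ρ n j + 1) :
    ∀ j ≤ n, ∀ c : PBond (F.P K) j, c.src ∈ (castSite '' Set.Icc (lo j) (hi j) : Set (Site (F.P K) j)) → c.tgt ∈ (castSite '' Set.Icc (lo j) (hi j) : Set (Site (F.P K) j)) →
      dist1 (Averaging.iter (avOfRecord F N K) j
        (gaugeAct (blockLift n (axialGauge (Averaging.iter (avOfRecord F N K) n U') (tLo (cornerP (F.P K) Mc ρ idx) ρ) (tHi (cornerP (F.P K) Mc ρ idx) (sideP (F.P K) Mc ρ) ρ))) U') c) ≤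
        (((F.P K).d - 1 : ℕ) : ℝ) * ((sideP (F.P K) Mc ρ + 4 * ρ - 1 : ℕ) : ℝ) * (2 * (((F.P K).L : ℝ) ^ 2 * ε)) +
          (7 * ((((((F.P K).d + 2) * (F.P K).L : ℕ) : ℝ) ^ 2 / 4)) +
              ((((((F.P K).d + 1) * ((F.P K).L - 1) : ℕ) : ℝ)) + 1) *
                (((((F.P K).d * ((F.P K).L - 1) + 1 : ℕ) : ℝ)) * (((((F.P K).d - 1 : ℕ) : ℝ) * (((F.P K).L - 1 : ℕ) : ℝ))))) *
            ∑ i ∈ Finset.Ico j n, 2 * (((F.P K).L : ℝ) ^ 2 * ε) * ((((F.P K).L : ℝ) ^ i * (F.P K).eta n) ^ 2) := by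
  obtain ⟨x, y, hx, hy, hxy⟩ := hdat
  have hρ0 : 0 < ρ := lt_of_lt_of_le (F.P K).L_pos hρ
  have hM : 1 ≤ sideP (F.P K) Mc ρ := by have := le_sideP (P := F.P K) Mc hρ0; omega
  have hα : 0 < ((F.P K).L : ℝ) ^ 2 * ε := by have := (F.P K).L_pos; positivity
  refine dist1_iter_le_down_the_radialRep_levelBoxes_of_fine hn1 hnK U' hax (cornerP (F.P K) Mc ρ idx) hM (by omega) hwrap hlo0 hhi0 hloj hhij hα hε3 hε2 ?_
  -- `h52`: the widened fine □̃ lies in the (17)-region one level down, and `ε·η_{n−1}² = L²ε·η_n²`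
  intro q hq
  obtain ⟨z, hz, hsrc⟩ := hq
  rw [← mul_eta_pred_sq (F.P K) ε hn1]
  exact h17 q (mem_omegaPlaqsTop_pred_of_mem_tildeTowerWide_zero hM₁ s hsep hρ0 hfloor hn1 hnk hx hy hxy hz hsrc)

end Datum

end Summit.QuantumFields.YangMills.BalabanUVNodes.N07TildeTowerLettersAtDatum
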